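import Summits.AtomisticToContinuum.FouriersLaw.Theses.BondHeatUncertainty
import Summits.AtomisticToContinuum.FouriersLaw.Theorems.SubBallisticWindow.Negative.ClosedFlow
import Literature.MathematicalPhysics.KineticTheory.LangevinChainKernel

/-!
# Weighted local energy balance along the OPEN Langevin chain, and the tent splitting of a bond heat

Support file for item `stmt-AtomisticToContinuum-9123` (`BondHeatUncertainty.LightConeBondHeat`, (S_lc): the
light-cone `√t`-law of the equilibrium single-bond heat variance `V_N(b,t)`), first half of the BULK-BOND (tent /
block-averaging) reduction of (S_lc).  Every bulk-bond argument rests on local energy conservation in the interior of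
the chain.  For a weight sequence `w : ℕ → ℝ` vanishing at the two bath sites, the weighted site energy
`W_w = ∑_k w_k h_k` (`SubBallisticWindow.Negative.ClosedFlow.weightedEnergy`, bond terms split evenly) does not see the
thermostats, and along the pathwise flow `z = chainFlow x η` of `LangevinChainSDE.lean` (any continuous momentum noise
`η` living on the bath sites) it obeys the deterministic balance

  `W_w(z t) = W_w(x) + ∫₀ᵗ ∑_k (w_{k+1} - w_k) j_k(z s) ds`        (`pinnedChain_weightedEnergy_chainFlow_eq`),

i.e. the closed-chain identity `{H, W_w} = ∑_k (w_{k+1} - w_k) j_k` (`poisson_hamiltonian_weightedEnergy`) transported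
to the open chain (`pinnedChain_weightedEnergy_solMap_eq` for the solution map `Φ_t(x,w) = OscillatorChain.solMap`
behind the constructed kernels).  With the TENT weights `w_k = (b₀ + L + 1 - k)/(L + 1)` on `b₀ < k ≤ b₀ + L` (zero
elsewhere) the discrete gradient is `[k = b₀] - [b₀ ≤ k ≤ b₀ + L]/(L+1)` (`tent_grad`, `sum_tent_grad_mul`), whence the
pathwise TENT SPLITTING of the heat through bond `b₀` into a block average plus an energy coboundary:

  `∫₀ᵗ j_{b₀}(Φ_s) ds = (L+1)⁻¹ ∫₀ᵗ J_{[b₀, b₀+L]}(Φ_s) ds + (W_w(Φ_t) - W_w(x))`   (`pinnedChain_bondHeat_tent_split`),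

`J_{[b₀,b₀+L]} = ∑_{b₀ ≤ k ≤ b₀+L} j_k`, valid whenever `b₀ + L + 1 < N` (all sites `b₀+1, …, b₀+L` interior).  The second
half (`…LightConeBondHeatTentReduction`) squares and integrates this against `μ_T ⊗ W`.  Nothing here closes an item.
-/

noncomputable section

open MeasureTheory Filter Topology Set intervalIntegral
open scoped NNReal

namespace Summit.AtomisticToContinuum.FouriersLaw.Theorems.LightConeBondHeat

open Literature.MathematicalPhysics.KineticTheory.HeatConduction
open Literature.MathematicalPhysics.KineticTheory Literature.Probability.Process OscillatorChain
open Summit.AtomisticToContinuum.FouriersLaw.Theorems.SubBallisticWindow.Negative.ClosedFlow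

variable {N : ℕ}

/-! ### The weighted energy does not see momenta where the weight vanishes -/

/-- Shifting the momenta at sites where the weight vanishes does not change `W_w`. [folklore] -/
theorem weightedEnergy_momentum_shift (P : OscillatorChain) (w : ℕ → ℝ) (x : PhaseSpace N) (η : Fin N → ℝ)
    (h : ∀ k : Fin N, w k.val = 0 ∨ η k = 0) :
    weightedEnergy P w N (x.1, x.2 + η) = weightedEnergy P w N x := by
  unfold weightedEnergy
  congr 1
  refine Finset.sum_congr rfl fun k _ => ?_
  rcases h k with hk | hk
  · simp [hk]
  · simp [hk]

/-! ### The drift derivative of `W_w` is `{H, W_w}` when the weight vanishes at the baths -/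

/-- **`DW_w(y)·Y(z) = ∑_k (w_{k+1} - w_k) j_k(z)`** for the Langevin drift `Y` of the pinned chain, whenever `w`
vanishes at the bath sites (`w_i · bathWeight N i = 0`), `y` and `z` have the same positions and `w_i p_i(y) = w_i p_i(z)`
(so `y` may differ from `z` in the bath momenta): the friction part of `Y` and the bath momenta drop out, and what is
left is the Poisson bracket `{H, W_w}(z)` of `poisson_hamiltonian_weightedEnergy`. [folklore] -/
theorem fderiv_weightedEnergy_drift (ω₂ lam β γ : ℝ) (w : ℕ → ℝ)
    (hw : ∀ i : Fin N, w i.val * bathWeight N i = 0) {y z : PhaseSpace N} (h1 : y.1 = z.1)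
    (h2 : ∀ i : Fin N, w i.val * y.2 i = w i.val * z.2 i) :
    fderiv ℝ (weightedEnergy (pinnedChain ω₂ lam β γ) w N) y ((pinnedChain ω₂ lam β γ).drift N z) =
      ∑ k : Fin N, (w (k.val + 1) - w k.val) * (pinnedChain ω₂ lam β γ).bondCurrent N k z := by
  set P := pinnedChain ω₂ lam β γ with hP
  have hU : Differentiable ℝ P.U := (pinnedChain_contDiff_U ω₂ lam β γ (n := 1)).differentiable one_ne_zero
  have hV : Differentiable ℝ P.V := (pinnedChain_contDiff_V ω₂ lam β γ (n := 1)).differentiable one_ne_zero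
  have hWd : Differentiable ℝ (weightedEnergy P w N) :=
    (contDiff_weightedEnergy P (pinnedChain_contDiff_U ω₂ lam β γ (n := 1))
      (pinnedChain_contDiff_V ω₂ lam β γ (n := 1)) w N).differentiable one_ne_zero
  rw [clm_apply_eq_sum]
  have hQ : ∀ i : Fin N, fderiv ℝ (weightedEnergy P w N) y (unitQ i) = dWeightedEnergy P w N i z.1 := by
    intro i
    rw [unitQ_eq, ← congrFun (partialQ_eq_fderiv hWd i) y, partialQ_weightedEnergy P hU hV, h1]
  have hPi : ∀ i : Fin N, fderiv ℝ (weightedEnergy P w N) y (unitP i) = w i.val * z.2 i := by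
    intro i
    rw [unitP_eq, ← congrFun (partialP_eq_fderiv hWd i) y, partialP_weightedEnergy P, h2 i]
  have hd1 : ∀ i : Fin N, (P.drift N z).1 i = z.2 i := fun i => rfl
  have hd2 : ∀ i : Fin N, (P.drift N z).2 i = -P.dPotential N i z.1 - P.γ * bathWeight N i * z.2 i := by
    intro i
    show -partialQ i (P.hamiltonian N) z - P.γ * bathWeight N i * z.2 i = _
    rw [P.partialQ_hamiltonian_eq_dPotential hU hV]
  simp only [hQ, hPi, hd1, hd2, smul_eq_mul]
  rw [← poisson_hamiltonian_weightedEnergy P hU hV w N z]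
  unfold poisson
  simp only [P.partialP_hamiltonian, P.partialQ_hamiltonian_eq_dPotential hU hV, partialP_weightedEnergy P,
    partialQ_weightedEnergy P hU hV]
  rw [← Finset.sum_add_distrib]
  refine Finset.sum_congr rfl fun i _ => ?_
  linear_combination (-(P.γ * z.2 i * z.2 i)) * hw i

/-! ### The weighted energy balance along the driven flow -/

/-- **Weighted local energy balance along the open chain, path by path** (pinned chain, `ω₂ > 0`, `lam, β, γ ≥ 0`):
if the weights vanish at the bath sites (`w 0 = 0`, `w (N-1) = 0`) and the continuous momentum noise `η` acts on the
bath sites only, then along `z = chainFlow x η`, for `t ≥ 0`,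
`W_w(z t) = W_w(x) + ∫₀ᵗ ∑_k (w_{k+1} - w_k) j_k(z s) ds`.  Proof: `y = z - (0, η)` is `C¹` with `y' = Y(z)`;
`W_w(z) = W_w(y)` (momentum shift at the baths); chain rule + `fderiv_weightedEnergy_drift`; integrate. [folklore] -/
theorem pinnedChain_weightedEnergy_chainFlow_eq {ω₂ lam β γ : ℝ} (hω : 0 < ω₂) (hl : 0 ≤ lam) (hβ : 0 ≤ β)
    (hγ : 0 ≤ γ) (w : ℕ → ℝ) (hw : ∀ i : Fin N, (i.val = 0 ∨ i.val = N - 1) → w i.val = 0)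
    (x : PhaseSpace N) {η : ℝ → Fin N → ℝ} (hη : Continuous η)
    (hηw : ∀ (s : ℝ) (i : Fin N), i.val ≠ 0 → i.val ≠ N - 1 → η s i = 0) {t : ℝ} (ht : 0 ≤ t) :
    weightedEnergy (pinnedChain ω₂ lam β γ) w N ((pinnedChain ω₂ lam β γ).chainFlow N x η t) =
      weightedEnergy (pinnedChain ω₂ lam β γ) w N x +
        ∫ s in (0 : ℝ)..t, ∑ k : Fin N, (w (k.val + 1) - w k.val) *
          (pinnedChain ω₂ lam β γ).bondCurrent N k ((pinnedChain ω₂ lam β γ).chainFlow N x η s) := by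
  set P := pinnedChain ω₂ lam β γ with hP
  set Y := P.drift N with hYdef
  set z := P.chainFlow N x η with hzdef
  -- the two pointwise consequences of the support conditions
  have hwη : ∀ (s : ℝ) (k : Fin N), w k.val = 0 ∨ η s k = 0 := by
    intro s k
    by_cases hk : k.val = 0 ∨ k.val = N - 1
    · exact Or.inl (hw k hk)
    · push Not at hk
      exact Or.inr (hηw s k hk.1 hk.2)
  have hwb : ∀ i : Fin N, w i.val * bathWeight N i = 0 := by
    intro i
    by_cases hi : i.val = 0 ∨ i.val = N - 1
    · rw [hw i hi, zero_mul]
    · push Not at hi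
      unfold bathWeight
      rw [if_neg hi.1, if_neg hi.2]; ring
  have hWd : Differentiable ℝ (weightedEnergy P w N) :=
    (contDiff_weightedEnergy P (pinnedChain_contDiff_U ω₂ lam β γ (n := 1))
      (pinnedChain_contDiff_V ω₂ lam β γ (n := 1)) w N).differentiable one_ne_zero
  have hWc : Continuous (weightedEnergy P w N) := hWd.continuous
  have hYc : Continuous Y := (pinnedChain_contDiff_drift ω₂ lam β γ N (n := 0)).continuous
  have hzc : Continuous z := pinnedChain_continuous_chainFlow hω hl hβ hγ N x hη
  have hz_eq : ∀ s ∈ Icc 0 t, z s = forcing x η s + ∫ r in (0 : ℝ)..s, Y (z r) :=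
    pinnedChain_isIntegralSolutionOn_chainFlow hω hl hβ hγ N x hη t
  -- `y(t) = x + ∫₀ᵗ Y(z)`, `y' = Y(z)`, `z = (y.1, y.2 + η)` on `[0, t]`
  set y : ℝ → PhaseSpace N := fun s => x + ∫ r in (0 : ℝ)..s, Y (z r) with hydef
  have hy_deriv : ∀ s, HasDerivAt y (Y (z s)) s := fun s => by
    have h1 : HasDerivAt (fun u => ∫ r in (0 : ℝ)..u, Y (z r)) (Y (z s)) s :=
      ((hYc.comp hzc).integral_hasStrictDerivAt 0 s).hasDerivAt
    exact h1.const_add x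
  have hy_eq : ∀ s ∈ Icc 0 t, y s = z s - ((0 : Fin N → ℝ), η s) := fun s hs => by
    rw [hz_eq s hs]
    simp only [hydef, forcing]
    abel
  have hzy : ∀ s ∈ Icc 0 t, z s = ((y s).1, (y s).2 + η s) := fun s hs => by
    rw [hy_eq s hs]
    ext i <;> simp
  have hy1 : ∀ s ∈ Icc 0 t, (y s).1 = (z s).1 := fun s hs => by
    rw [hy_eq s hs]; simp
  have hy2 : ∀ s ∈ Icc 0 t, ∀ i : Fin N, w i.val * (y s).2 i = w i.val * (z s).2 i := fun s hs i => by
    rw [hy_eq s hs]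
    rcases hwη s i with h | h
    · simp [h]
    · simp [h]
  have hy0 : y 0 = x := by simp [hydef]
  have hWzy : ∀ s ∈ Icc 0 t, weightedEnergy P w N (z s) = weightedEnergy P w N (y s) := fun s hs => by
    rw [hzy s hs]
    exact weightedEnergy_momentum_shift P w (y s) (η s) (hwη s)
  -- the derivative of `W_w ∘ y`
  set F : ℝ → ℝ := fun s => ∑ k : Fin N, (w (k.val + 1) - w k.val) * P.bondCurrent N k (z s) with hF
  have hderiv : ∀ s ∈ Icc 0 t, HasDerivAt (fun s => weightedEnergy P w N (y s)) (F s) s := by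
    intro s hs
    have h := (hWd (y s)).hasFDerivAt.comp_hasDerivAt s (hy_deriv s)
    have hval : fderiv ℝ (weightedEnergy P w N) (y s) (Y (z s)) = F s :=
      fderiv_weightedEnergy_drift ω₂ lam β γ w hwb (hy1 s hs) (hy2 s hs)
    rw [hval] at h
    exact h
  have hFc : Continuous F := by
    simp only [hF]
    exact continuous_finsetSum _ fun k _ =>
      continuous_const.mul ((pinnedChain_continuous_bondCurrent ω₂ lam β γ N k).comp hzc)
  -- the fundamental theorem of calculus on `[0, t]`
  have hFTC : ∫ s in (0 : ℝ)..t, F s = weightedEnergy P w N (y t) - weightedEnergy P w N (y 0) := by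
    refine intervalIntegral.integral_eq_sub_of_hasDerivAt_of_le ht
      ((hWc.comp (continuous_iff_continuousAt.2 fun s => (hy_deriv s).continuousAt)).continuousOn)
      (fun s hs => hderiv s ⟨hs.1.le, hs.2.le⟩) (hFc.intervalIntegrable _ _)
  rw [hWzy t ⟨ht, le_rfl⟩, hy0] at *
  linarith [hFTC]

/-- **Weighted local energy balance along the constructed flow** `Φ_t(x, w') = OscillatorChain.solMap` (the pathwise
solution behind the transition kernels, driven by the noise `chainNoise` of a raw pair of paths `w'`, which acts on
the bath sites `0` and `N - 1` only): for the pinned chain (`ω₂ > 0`, `lam, β, γ ≥ 0`), all `T_L, T_R`, weights `w`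
with `w 0 = 0 = w (N-1)`, every `x`, `w'` and `t ≥ 0`,
`W_w(Φ_t(x,w')) = W_w(x) + ∫₀ᵗ ∑_k (w_{k+1} - w_k) j_k(Φ_s(x,w')) ds`. [folklore] -/
theorem pinnedChain_weightedEnergy_solMap_eq {ω₂ lam β γ : ℝ} (hω : 0 < ω₂) (hl : 0 ≤ lam) (hβ : 0 ≤ β)
    (hγ : 0 ≤ γ) (T_L T_R : ℝ) (w : ℕ → ℝ) (hw : ∀ i : Fin N, (i.val = 0 ∨ i.val = N - 1) → w i.val = 0)
    (x : PhaseSpace N) (w' : WienerPair) {t : ℝ} (ht : 0 ≤ t) :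
    weightedEnergy (pinnedChain ω₂ lam β γ) w N ((pinnedChain ω₂ lam β γ).solMap N T_L T_R t x w') =
      weightedEnergy (pinnedChain ω₂ lam β γ) w N x +
        ∫ s in (0 : ℝ)..t, ∑ k : Fin N, (w (k.val + 1) - w k.val) *
          (pinnedChain ω₂ lam β γ).bondCurrent N k ((pinnedChain ω₂ lam β γ).solMap N T_L T_R s x w') := by
  unfold OscillatorChain.solMap
  refine pinnedChain_weightedEnergy_chainFlow_eq hω hl hβ hγ w hw x (continuous_chainNoise _ _ w') ?_ ht
  intro s i hi0 hiN
  simp [chainNoise, hi0, hiN]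

/-! ### Tent weights -/

/-- The discrete gradient of the TENT weights `w_k = (b₀ + L + 1 - k)/(L + 1)` on `b₀ < k ≤ b₀ + L` (zero elsewhere):
`w_{k+1} - w_k = [k = b₀] - [b₀ ≤ k ≤ b₀ + L]/(L + 1)`. [folklore] -/
theorem tent_grad (b₀ L k : ℕ) :
    (fun k : ℕ => if b₀ < k ∧ k ≤ b₀ + L then ((b₀ : ℝ) + L + 1 - k) / (L + 1) else 0) (k + 1) -
        (fun k : ℕ => if b₀ < k ∧ k ≤ b₀ + L then ((b₀ : ℝ) + L + 1 - k) / (L + 1) else 0) k =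
      (if k = b₀ then (1 : ℝ) else 0) - (if b₀ ≤ k ∧ k ≤ b₀ + L then 1 / ((L : ℝ) + 1) else 0) := by
  have hL : (L : ℝ) + 1 ≠ 0 := by positivity
  simp only
  rcases Nat.lt_trichotomy k b₀ with hlt | heq | hgt
  · -- `k < b₀`: every indicator vanishes
    rw [if_neg (show ¬(b₀ < k + 1 ∧ k + 1 ≤ b₀ + L) by omega), if_neg (show ¬(b₀ < k ∧ k ≤ b₀ + L) by omega),
      if_neg (show k ≠ b₀ by omega), if_neg (show ¬(b₀ ≤ k ∧ k ≤ b₀ + L) by omega)]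
  · -- `k = b₀`
    subst heq
    rw [if_neg (show ¬(k < k ∧ k ≤ k + L) by omega), if_pos rfl, if_pos (show k ≤ k ∧ k ≤ k + L by omega)]
    by_cases hL0 : L = 0
    · subst hL0
      rw [if_neg (show ¬(k < k + 1 ∧ k + 1 ≤ k + 0) by omega)]
      norm_num
    · rw [if_pos (show k < k + 1 ∧ k + 1 ≤ k + L by omega)]
      push_cast
      field_simp
      ring
  · -- `b₀ < k`
    rw [if_neg (show k ≠ b₀ by omega)]
    by_cases h5 : k ≤ b₀ + L
    · rw [if_pos (show b₀ < k ∧ k ≤ b₀ + L from ⟨hgt, h5⟩), if_pos (show b₀ ≤ k ∧ k ≤ b₀ + L from ⟨hgt.le, h5⟩)]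
      by_cases h3 : k + 1 ≤ b₀ + L
      · rw [if_pos (show b₀ < k + 1 ∧ k + 1 ≤ b₀ + L by omega)]
        push_cast
        field_simp
        ring
      · rw [if_neg (show ¬(b₀ < k + 1 ∧ k + 1 ≤ b₀ + L) by omega)]
        have hk : k = b₀ + L := by omega
        subst hk
        push_cast
        field_simp
        ring
    · rw [if_neg (show ¬(b₀ < k + 1 ∧ k + 1 ≤ b₀ + L) by omega), if_neg (show ¬(b₀ < k ∧ k ≤ b₀ + L) by omega),
        if_neg (show ¬(b₀ ≤ k ∧ k ≤ b₀ + L) by omega)]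

/-- Summing a sequence against the gradient of the tent weights picks out the bond `b₀` minus the block average:
`∑_k (w_{k+1} - w_k) f_k = f_{b₀} - (L+1)⁻¹ ∑_{b₀ ≤ k ≤ b₀+L} f_k` (`b₀ < N`). [folklore] -/
theorem sum_tent_grad_mul {b₀ : ℕ} (L : ℕ) (hb : b₀ < N) (f : Fin N → ℝ) :
    ∑ k : Fin N, ((fun k : ℕ => if b₀ < k ∧ k ≤ b₀ + L then ((b₀ : ℝ) + L + 1 - k) / (L + 1) else 0) (k.val + 1) -
        (fun k : ℕ => if b₀ < k ∧ k ≤ b₀ + L then ((b₀ : ℝ) + L + 1 - k) / (L + 1) else 0) k.val) * f k =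
      f ⟨b₀, hb⟩ - (1 / ((L : ℝ) + 1)) * ∑ k : Fin N, (if b₀ ≤ k.val ∧ k.val ≤ b₀ + L then f k else 0) := by
  simp only [tent_grad, sub_mul, Finset.sum_sub_distrib, ite_mul, one_mul, zero_mul]
  congr 1
  · rw [Finset.sum_eq_single ⟨b₀, hb⟩]
    · simp
    · intro k _ hk
      rw [if_neg]
      intro h; exact hk (Fin.ext h)
    · simp
  · rw [Finset.mul_sum]
    refine Finset.sum_congr rfl fun k _ => ?_
    split_ifs <;> ring

/-! ### The tent splitting of a bond heat along the constructed flow -/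

/-- **Tent splitting of the heat through bond `b₀`, path by path.**  For the pinned chain (`ω₂ > 0`, `lam, β, γ ≥ 0`),
all `T_L, T_R`, a bond `b₀` and a block length `L` with `b₀ + L + 1 < N`, every `x`, raw pair `w'` and `t ≥ 0`:
`∫₀ᵗ j_{b₀}(Φ_s) ds = (L+1)⁻¹ ∫₀ᵗ J(Φ_s) ds + (W(Φ_t) - W(x))`, where `Φ_s = Φ_s(x,w')` is the solution map,
`J = ∑_{b₀ ≤ k ≤ b₀+L} j_k` the block current and `W = W_w` the weighted energy with the tent weights
`w_k = (b₀ + L + 1 - k)/(L + 1)` on `b₀ < k ≤ b₀ + L`.  (Equivalently: averaging over `k` the conservation laws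
`∫₀ᵗ (j_{b₀} - j_{b₀+k}) = Δ(h_{b₀+1} + ⋯ + h_{b₀+k})`.) [folklore] -/
theorem pinnedChain_bondHeat_tent_split {ω₂ lam β γ : ℝ} (hω : 0 < ω₂) (hl : 0 ≤ lam) (hβ : 0 ≤ β) (hγ : 0 ≤ γ)
    (T_L T_R : ℝ) {b₀ L : ℕ} (hbL : b₀ + L + 1 < N) (x : PhaseSpace N) (w' : WienerPair) {t : ℝ} (ht : 0 ≤ t) :
    ∫ s in (0 : ℝ)..t, (pinnedChain ω₂ lam β γ).bondCurrent N ⟨b₀, by omega⟩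
        ((pinnedChain ω₂ lam β γ).solMap N T_L T_R s x w') =
      (1 / ((L : ℝ) + 1)) * (∫ s in (0 : ℝ)..t, ∑ k : Fin N, if b₀ ≤ k.val ∧ k.val ≤ b₀ + L then
          (pinnedChain ω₂ lam β γ).bondCurrent N k ((pinnedChain ω₂ lam β γ).solMap N T_L T_R s x w') else 0) +
      (weightedEnergy (pinnedChain ω₂ lam β γ)
          (fun k : ℕ => if b₀ < k ∧ k ≤ b₀ + L then ((b₀ : ℝ) + L + 1 - k) / (L + 1) else 0) N
          ((pinnedChain ω₂ lam β γ).solMap N T_L T_R t x w') -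
        weightedEnergy (pinnedChain ω₂ lam β γ)
          (fun k : ℕ => if b₀ < k ∧ k ≤ b₀ + L then ((b₀ : ℝ) + L + 1 - k) / (L + 1) else 0) N x) := by
  set wt : ℕ → ℝ := fun k : ℕ => if b₀ < k ∧ k ≤ b₀ + L then ((b₀ : ℝ) + L + 1 - k) / (L + 1) else 0 with hwt
  have hw : ∀ i : Fin N, (i.val = 0 ∨ i.val = N - 1) → wt i.val = 0 := by
    intro i hi
    simp only [hwt]
    rw [if_neg]
    omega
  have key := pinnedChain_weightedEnergy_solMap_eq hω hl hβ hγ T_L T_R wt hw x w' ht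
  have hsum : ∀ z : PhaseSpace N,
      ∑ k : Fin N, (wt (k.val + 1) - wt k.val) * (pinnedChain ω₂ lam β γ).bondCurrent N k z =
      (pinnedChain ω₂ lam β γ).bondCurrent N ⟨b₀, by omega⟩ z -
        (1 / ((L : ℝ) + 1)) * ∑ k : Fin N,
          (if b₀ ≤ k.val ∧ k.val ≤ b₀ + L then (pinnedChain ω₂ lam β γ).bondCurrent N k z else 0) :=
    fun z => sum_tent_grad_mul L (by omega : b₀ < N) (fun k => (pinnedChain ω₂ lam β γ).bondCurrent N k z)
  simp only [hsum] at key
  have hZc : Continuous fun s : ℝ => (pinnedChain ω₂ lam β γ).solMap N T_L T_R s x w' :=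
    pinnedChain_continuous_solMap hω hl hβ hγ N T_L T_R x w'
  have hI1 : IntervalIntegrable (fun s => (pinnedChain ω₂ lam β γ).bondCurrent N ⟨b₀, by omega⟩
      ((pinnedChain ω₂ lam β γ).solMap N T_L T_R s x w')) volume 0 t :=
    ((pinnedChain_continuous_bondCurrent ω₂ lam β γ N _).comp hZc).intervalIntegrable _ _
  have hI2 : IntervalIntegrable (fun s => (1 / ((L : ℝ) + 1)) * ∑ k : Fin N, (if b₀ ≤ k.val ∧ k.val ≤ b₀ + L then
      (pinnedChain ω₂ lam β γ).bondCurrent N k ((pinnedChain ω₂ lam β γ).solMap N T_L T_R s x w') else 0))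
      volume 0 t := by
    refine (Continuous.intervalIntegrable ?_ _ _)
    refine continuous_const.mul (continuous_finsetSum _ fun k _ => ?_)
    split_ifs
    · exact (pinnedChain_continuous_bondCurrent ω₂ lam β γ N k).comp hZc
    · exact continuous_const
  rw [intervalIntegral.integral_sub hI1 hI2, intervalIntegral.integral_const_mul] at key
  rw [key]
  ring

end Summit.AtomisticToContinuum.FouriersLaw.Theorems.LightConeBondHeat

end
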